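import Literature.AlgebraicGeometry.Motives.AbelianVarietyConjugate
import Literature.AlgebraicGeometry.Motives.AbelianVarietyBaseChangeTowerFst
import Literature.NumberTheory.DiophantineGeometry.AVGaloisModule
import HarnessLib

/-!
# Conjugation commutes with base change along an extension of the automorphism:
# `(A^γ) ⊗_k L ≅ (A ⊗_k L)^σ` for `σ|_k = γ` (Shimura 1998, §18.6: `A^σ` of an `L`-rational `A`, `σ|_L = [𝔓, L/K*]`)

Topic `Literature/AlgebraicGeometry/Motives`, namespace `Literature.AlgebraicGeometry.Motives[.AbelianVariety]`.
Definitions with bodies and theorems; no named fact, no instance (D-0026: net Literature debt **0**).  Written for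
the cell `hodgecm-mathlib` (D-0151), fan B-II, line `b2-main-theorem-cm` v2, glue «G-conj / G-conj2» of the
assembly S7 of row II-1 (Shimura 1998, Thm. 18.6 (2)).

## The printed use (opened)

G. Shimura, *Abelian Varieties with Complex Multiplication and Modular Functions* (Princeton 1998) [Shimura1998],
§18.6, proof of Thm. 18.6 (held chunks p0165 L15 – p0168 L12, printed pp. 126–128): the structure `(A, ι)` over `ℂ`
is replaced by a model rational over a number field `L` (§12.4 Prop. 26), `σ ∈ Aut(ℂ/K*)` is restricted to `L`
(`σ = [𝔓, L/K*]` on `L`, p. 127 condition (3)), and from then on `A^σ`, `ι^σ`, `t^σ` are computed on the `L`-MODEL: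
«`(Y^σ)~ = Ỹ^f` for every object `Y` rational over `L`» (p. 127), «`r(w)^σ = κ(r(w))`» (p. 128).  The tacit
identification is the subject of this file: for a field extension `k → L`, an automorphism `γ` of `k` and an
automorphism `σ` of `L` EXTENDING it (`σ (x) = γ x` on `k`), and an abelian variety `A` over `k`,
`(A^γ) ⊗_k L ≅ (A ⊗_k L)^σ` canonically (both are `A ⊗_{k, ι∘γ = σ∘ι} L`; Görtz–Wedhorn I, Prop. 4.16,
transitivity of fibre products), compatibly with homomorphisms (`(f^γ)_L ↔ (f_L)^σ`, Milne 2005 §11 «the functor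
σ») and with POINTS: the `L`-point `(x^γ)_L` of `(A^γ)_L` attached to a `k`-rational point `x` corresponds to the
conjugate point `(x_L)^σ` of `(A_L)^σ` (Shimura's `t^σ` for `t ∈ A[M]` rational over `L`, read on `A ⊗ ℂ`).  The case
`L = ℂ`, `k` = Shimura's `L`, is the glue «G-conj» of the cell; the case of a normal tower of number fields
`L₀ ⊆ L₁`, `σ ∈ Aut(L₁)`, `γ = σ|_{L₀}`, is «G-conj2» (p. 127 condition (4) quantifies over the conjugates `A_i^γ`).

## What is here

* §1 `pullbackComp_hom_app_left_comp_fst_fst`: the `hom` direction of the tree's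
  `pullbackComp_inv_app_left_comp_fst` (`Motives/AbelianVarietyBaseChangeTowerFst`): the component of Mathlib's
  `Over.pullbackComp f g` commutes with the (double) first projection.
* §2 (schemes) `twistFunctor γ = Over.pullback (Spec γ)` (= `bcFunctor k (AlongHom k γ)` by `rfl`, the functor
  underlying `AbelianVariety.conjugate γ`), the exchange isomorphism
  **`twistBaseChangeCommIso γ σ hσ : twistFunctor γ ⋙ bcFunctor k L ≅ bcFunctor k L ⋙ twistFunctor σ`** and its
  first-projection formula `twistBaseChangeCommIso_hom_app_left_fst_fst`.
* §3 (abelian varieties) **`AbelianVariety.conjugateBaseChangeAlongIso γ σ hσ A : (A.conjugate γ).baseChange L ≅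
  (A.baseChange L).conjugate σ`** (via `Functor.mapGrp`, as the tree's `baseChangeTowerIso`), its NATURALITY
  `Hom.baseChange_conjugate_comp_conjugateBaseChangeAlongIso_hom` (`(f^γ)_L ≫ e_B = e_A ≫ (f_L)^σ`), the conjugation
  form for endomorphisms, the first-projection formula `toSchemeHom_conjugateBaseChangeAlongIso_hom_comp_fst_fst`,
  and the POINTS formula **`map_conjugateBaseChangeAlongIso_hom_pointsMulEquiv_extendScalars_conjPoints`**:
  `e (((x^γ))_L) = (x_L)^σ` for `x ∈ A(k)` (`conjPoints`, `pointsMulEquiv`, `AlgPoints.extendScalars` of the tree),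
  with the «two projections» uniqueness lemma `Points.conjugate_baseChange_ext` it rests on.

## References

* [Shimura1998] G. Shimura, *Abelian Varieties with Complex Multiplication and Modular Functions*, Princeton 1998,
  §18.6 proof of Thm. 18.6, pp. 126–128.
* [GortzWedhorn2020] U. Görtz, T. Wedhorn, *Algebraic Geometry I*, 2nd ed., Prop. 4.16 and §(4.7) (transitivity of
  base change), Remark 16.54 (base change of group schemes).
* [Milne2005ShimuraVarieties] J. S. Milne, *Introduction to Shimura varieties*, §11 p. 108 («the functor σ», `σP`).
-/

noncomputable section

-- Compositions through `((Over.pullback f).obj X).left` and the induced-category homs of `AbelianVariety` are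
-- definitional only above `instances` transparency (as in Mathlib's `CategoryTheory.Over.pullback` API).
set_option backward.isDefEq.respectTransparency false

open CategoryTheory CategoryTheory.Limits AlgebraicGeometry

universe u

namespace Literature.AlgebraicGeometry.Motives

/-! ### §1. Components of `Over.pullbackComp` and first projections (hom direction) -/

section PullbackComp

/-- **The transitivity isomorphism commutes with the first projections, `hom` direction**: the component at `W` of
Mathlib's `Over.pullbackComp f g : pullback (f ≫ g) ≅ pullback g ⋙ pullback f`, followed by the two first
projections, is the first projection of `W ×_Z X` (Görtz–Wedhorn I, Prop. 4.16, «canonical»; the `inv` direction is the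
tree's `pullbackComp_inv_app_left_comp_fst`, `Motives/AbelianVarietyBaseChangeTowerFst`).
[cite: GortzWedhorn2020, Prop. 4.16 and §(4.7)] -/
@[reassoc]
theorem pullbackComp_hom_app_left_comp_fst_fst {X Y Z : Scheme.{u}} (f : X ⟶ Y) (g : Y ⟶ Z) (W : Over Z) :
    ((Over.pullbackComp f g).hom.app W).left ≫ pullback.fst ((Over.pullback g).obj W).hom f ≫
        pullback.fst W.hom g = pullback.fst W.hom (f ≫ g) := by
  rw [← pullbackComp_inv_app_left_comp_fst f g W, ← Over.comp_left_assoc, Iso.hom_inv_id_app, Over.id_left,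
    Category.id_comp]

end PullbackComp

/-! ### §2. The twist functor and the exchange isomorphism `(− ⊗_γ k) ⊗_k L ≅ (− ⊗_k L) ⊗_σ L` -/

namespace AbelianVariety

section Scheme

variable {k L : Type u} [Field k] [Field L] [Algebra k L] (γ : k ≃+* k) (σ : L ≃+* L)

/-- `Spec γ : Spec k → Spec k` for a field automorphism `γ`. [cite: GortzWedhorn2020, §(4.7)] -/
abbrev specRingEquiv (γ : k ≃+* k) : Spec (.of k) ⟶ Spec (.of k) := Spec.map (CommRingCat.ofHom γ.toRingHom)

/-- **The twist functor `X ↦ X^γ = X ×_{Spec k, Spec γ} Spec k`** on `k`-schemes, as Mathlib's `Over.pullback` (so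
that its cartesian-monoidal structure is found by unification); it IS the tree's `bcFunctor k (AlongHom k γ)`
underlying `AbelianVariety.conjugate γ` (`twistFunctor_eq_bcFunctor`, `rfl`). [cite: GortzWedhorn2020, Section (4.7)] -/
abbrev twistFunctor (γ : k ≃+* k) : SchemeOver k ⥤ SchemeOver k := Over.pullback (specRingEquiv γ)

/-- `twistFunctor γ` is base change along `γ` read as the `k`-algebra `AlongHom k γ` (by `rfl`).
[cite: GortzWedhorn2020, Section (4.7)] -/
theorem twistFunctor_eq_bcFunctor : twistFunctor γ = bcFunctor k (AlongHom k γ.toRingHom) := rfl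

/-- `twistFunctor γ` is the tree's `baseChangeHom γ` (by `rfl`). [cite: GortzWedhorn2020, Section (4.7)] -/
theorem twistFunctor_eq_baseChangeHom : twistFunctor γ = baseChangeHom γ.toRingHom := rfl

variable (hσ : ∀ x, σ (algebraMap k L x) = algebraMap k L (γ x))
include hσ

/-- If `σ` extends `γ` along `k → L` then `Spec(L → k) ≫ Spec γ = Spec σ ≫ Spec(L → k)`.
[cite: GortzWedhorn2020, Section (4.7)] -/
theorem bcSpec_comp_specRingEquiv :
    bcSpec k L ≫ specRingEquiv γ = specRingEquiv σ ≫ bcSpec k L := by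
  change Spec.map _ ≫ Spec.map _ = Spec.map _ ≫ Spec.map _
  rw [← Spec.map_comp, ← Spec.map_comp, ← CommRingCat.ofHom_comp, ← CommRingCat.ofHom_comp]
  congr 2
  exact RingHom.ext fun x ↦ (hσ x).symm

/-- **The exchange isomorphism `(X^γ) ⊗_k L ≅ (X ⊗_k L)^σ`**, naturally in the `k`-scheme `X`, for `σ` extending
`γ` (both sides are `X ⊗_{k, ι∘γ} L = X ⊗_{k, σ∘ι} L`; Görtz–Wedhorn I, Prop. 4.16; Mathlib `Over.pullbackComp`).
[cite: GortzWedhorn2020, Prop. 4.16 and §(4.7)] -/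
def twistBaseChangeCommIso : twistFunctor γ ⋙ bcFunctor k L ≅ bcFunctor k L ⋙ twistFunctor σ :=
  (Over.pullbackComp (bcSpec k L) (specRingEquiv γ)).symm ≪≫
    overPullbackCongr (bcSpec_comp_specRingEquiv γ σ hσ) ≪≫
      Over.pullbackComp (specRingEquiv σ) (bcSpec k L)

/-- **First-projection formula for the exchange isomorphism**: followed by the projections
`(X ⊗_k L)^σ → X ⊗_k L → X`, it is `(X^γ) ⊗_k L → X^γ → X`. [cite: GortzWedhorn2020, Prop. 4.16 and §(4.7)] -/
@[reassoc]
theorem twistBaseChangeCommIso_hom_app_left_fst_fst (X : SchemeOver k) :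
    ((twistBaseChangeCommIso γ σ hσ).hom.app X).left ≫
        pullback.fst ((bcFunctor k L).obj X).hom (specRingEquiv σ) ≫ pullback.fst X.hom (bcSpec k L) =
      pullback.fst ((twistFunctor γ).obj X).hom (bcSpec k L) ≫ pullback.fst X.hom (specRingEquiv γ) := by
  rw [twistBaseChangeCommIso, Iso.trans_hom, Iso.trans_hom, NatTrans.comp_app, NatTrans.comp_app, Over.comp_left,
    Over.comp_left, Category.assoc, Category.assoc, pullbackComp_hom_app_left_comp_fst_fst, Iso.symm_hom,
    overPullbackCongr_hom_app_left_comp_fst, pullbackComp_inv_app_left_comp_fst]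

end Scheme

/-! ### §3. `(A^γ) ⊗_k L ≅ (A ⊗_k L)^σ` as abelian varieties, naturality, projections and points -/

section AV

open scoped MonObj

variable {k L : Type u} [Field k] [Field L] [Algebra k L] (γ : k ≃+* k) (σ : L ≃+* L)
  (hσ : ∀ x, σ (algebraMap k L x) = algebraMap k L (γ x))

include hσ in
/-- The exchange isomorphism on GROUP objects (`Functor.mapGrp` of `twistBaseChangeCommIso`, composed with
`mapGrp (F ⋙ G) ≅ mapGrp F ⋙ mapGrp G`; Görtz–Wedhorn I, Remark 16.54). [cite: GortzWedhorn2020, Prop. 4.16 and Remark 16.54] -/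
def conjugateBaseChangeGrpNatIso :
    (twistFunctor γ).mapGrp ⋙ (bcFunctor k L).mapGrp ≅ (bcFunctor k L).mapGrp ⋙ (twistFunctor σ).mapGrp :=
  (Functor.mapGrpCompIso (F := twistFunctor γ) (G := bcFunctor k L)).symm ≪≫
    Functor.mapGrpNatIso (twistBaseChangeCommIso γ σ hσ) ≪≫
      Functor.mapGrpCompIso (F := bcFunctor k L) (G := twistFunctor σ)

/-- The group `L`-scheme underlying `(A^γ) ⊗_k L` (by `rfl`). [cite: GortzWedhorn2020, Remark 16.54] -/
theorem conjugateAlong_baseChange_toGrp (A : AbelianVariety k) :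
    ((A.conjugate γ).baseChange L).toGrp = (bcFunctor k L).mapGrp.obj ((twistFunctor γ).mapGrp.obj A.toGrp) := rfl

/-- The group `L`-scheme underlying `(A ⊗_k L)^σ` (by `rfl`). [cite: GortzWedhorn2020, Remark 16.54] -/
theorem baseChange_conjugateAlong_toGrp (A : AbelianVariety k) :
    ((A.baseChange L).conjugate σ).toGrp = (twistFunctor σ).mapGrp.obj ((bcFunctor k L).mapGrp.obj A.toGrp) := rfl

include hσ in
/-- **`(A^γ) ⊗_k L ≅ (A ⊗_k L)^σ` as abelian varieties over `L`**, for an automorphism `σ` of `L` extending the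
automorphism `γ` of `k` (Shimura 1998, proof of Thm. 18.6: `A^σ` of the `L`-rational `A` is computed on the
`L`-model; Görtz–Wedhorn I, Prop. 4.16). [cite: Shimura1998, §18.6 proof of Thm. 18.6, pp. 127–128] -/
def conjugateBaseChangeAlongIso (A : AbelianVariety k) :
    (A.conjugate γ).baseChange L ≅ (A.baseChange L).conjugate σ :=
  InducedCategory.isoMk ((conjugateBaseChangeGrpNatIso γ σ hσ).app A.toGrp)

/-- On underlying schemes, `conjugateBaseChangeAlongIso γ σ hσ A` IS the component of `twistBaseChangeCommIso` at `A.X`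
(the group-object wrappers `Functor.mapGrpCompIso`, `Functor.mapGrpNatIso` do not change the underlying morphism; same
bookkeeping as the tree's `toSchemeHom_baseChangeTowerIso_hom`). [cite: GortzWedhorn2020, Prop. 4.16 and Remark 16.54] -/
theorem toSchemeHom_conjugateBaseChangeAlongIso_hom (A : AbelianVariety k) :
    Hom.toSchemeHom (conjugateBaseChangeAlongIso γ σ hσ A).hom = ((twistBaseChangeCommIso γ σ hσ).hom.app A.X).left := by
  simp [conjugateBaseChangeAlongIso, conjugateBaseChangeGrpNatIso, Hom.toSchemeHom]
  erw [Category.id_comp, Category.comp_id]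

variable {A B : AbelianVariety k}

/-- **Naturality: `(f^γ)_L ≫ e_B = e_A ≫ (f_L)^σ`** for a homomorphism `f : A → B` over `k` (Milne's functor `σ`;
base change of homomorphisms is functorial, Mumford §19). [cite: Milne2005ShimuraVarieties, §11 p. 108 («the functor σ»)] -/
@[reassoc]
theorem Hom.baseChange_conjugate_comp_conjugateBaseChangeAlongIso_hom (f : A ⟶ B) :
    Hom.baseChange L (Hom.conjugate γ f) ≫ (conjugateBaseChangeAlongIso γ σ hσ B).hom =
      (conjugateBaseChangeAlongIso γ σ hσ A).hom ≫ Hom.conjugate σ (Hom.baseChange L f) :=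
  InducedCategory.hom_ext ((conjugateBaseChangeGrpNatIso γ σ hσ).hom.naturality f.hom)

/-- … and for the inverses: `e_A⁻¹ ≫ (f^γ)_L = (f_L)^σ ≫ e_B⁻¹`. [cite: Milne2005ShimuraVarieties, §11 p. 108 («the functor σ»)] -/
@[reassoc]
theorem conjugateBaseChangeAlongIso_inv_comp_baseChange_conjugate (f : A ⟶ B) :
    (conjugateBaseChangeAlongIso γ σ hσ A).inv ≫ Hom.baseChange L (Hom.conjugate γ f) =
      Hom.conjugate σ (Hom.baseChange L f) ≫ (conjugateBaseChangeAlongIso γ σ hσ B).inv := by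
  rw [Iso.inv_comp_eq, ← Category.assoc, Iso.eq_comp_inv,
    Hom.baseChange_conjugate_comp_conjugateBaseChangeAlongIso_hom]

/-- **Endomorphism form** (transport of structures `ι : 𝓞_K → End A`): `e⁻¹ ≫ (r^γ)_L ≫ e = (r_L)^σ` for
`r ∈ End_k(A)` — the structure `((ι r)^γ)_L` of `(A^γ)_L` is carried to the structure `((ι r)_L)^σ = (ι^σ)(r)` of
`(A_L)^σ` (Shimura's `ι^σ`). [cite: Shimura1998, §18.6 proof of Thm. 18.6, pp. 127–128] -/
theorem conjugateBaseChangeAlongIso_conj (r : A ⟶ A) :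
    (conjugateBaseChangeAlongIso γ σ hσ A).inv ≫ Hom.baseChange L (Hom.conjugate γ r) ≫
        (conjugateBaseChangeAlongIso γ σ hσ A).hom = Hom.conjugate σ (Hom.baseChange L r) := by
  rw [Hom.baseChange_conjugate_comp_conjugateBaseChangeAlongIso_hom, Iso.inv_hom_id_assoc]

variable (A)

/-- **First-projection formula**: the isomorphism followed by `(A_L)^σ → A_L → A` is `(A^γ)_L → A^γ → A` on
underlying schemes. [cite: GortzWedhorn2020, Prop. 4.16 and §(4.7)] -/
@[reassoc]
theorem toSchemeHom_conjugateBaseChangeAlongIso_hom_comp_fst_fst :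
    Hom.toSchemeHom (conjugateBaseChangeAlongIso γ σ hσ A).hom ≫
        baseChangeHomFst σ.toRingHom (A.baseChange L).X ≫ pullback.fst A.X.hom (bcSpec k L) =
      pullback.fst (A.conjugate γ).X.hom (bcSpec k L) ≫ baseChangeHomFst γ.toRingHom A.X := by
  rw [toSchemeHom_conjugateBaseChangeAlongIso_hom]
  exact twistBaseChangeCommIso_hom_app_left_fst_fst γ σ hσ A.X

/-- **Two `L`-points of `(A ⊗_k L)^σ` with the same projection to `A` are equal** (an `L`-point of
`(A ×_k L) ×_{L,σ} L` is determined by its projection to `A`: its projections to the two copies of `Spec L` are the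
structure morphism and `Spec σ`). [cite: GortzWedhorn2020, Section (4.7) (points of a base change)] -/
theorem Points.conjugate_baseChange_ext {Q₁ Q₂ : ((A.baseChange L).conjugate σ).Points L}
    (h : Q₁.left ≫ baseChangeHomFst σ.toRingHom (A.baseChange L).X ≫ pullback.fst A.X.hom (bcSpec k L) =
      Q₂.left ≫ baseChangeHomFst σ.toRingHom (A.baseChange L).X ≫ pullback.fst A.X.hom (bcSpec k L)) :
    Q₁ = Q₂ := by
  apply Points.ext_of_comp_fst (σ := σ.toRingHom)
  apply pullback.hom_ext
  · simpa only [Category.assoc] using h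
  · -- both composites to `Spec L` are `Spec σ`: `Q.left ≫ pr ≫ (A_L → Spec L) = Q.left ≫ (A_L^σ → Spec L) ≫ Spec σ`
    have hsq : baseChangeHomFst σ.toRingHom (A.baseChange L).X ≫ pullback.snd A.X.hom (bcSpec k L) =
        ((A.baseChange L).conjugate σ).X.hom ≫ Spec.map (CommRingCat.ofHom σ.toRingHom) :=
      pullback.condition
    have h₁ : Q₁.left ≫ ((A.baseChange L).conjugate σ).X.hom = (specOver L L).hom := Over.w Q₁
    have h₂ : Q₂.left ≫ ((A.baseChange L).conjugate σ).X.hom = (specOver L L).hom := Over.w Q₂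
    rw [Category.assoc, Category.assoc, hsq, ← Category.assoc, ← Category.assoc, h₁, h₂]

/-- **The points formula: `e((x^γ)_L) = (x_L)^σ`** for a `k`-rational point `x ∈ A(k)`: the `L`-point of
`(A^γ) ⊗_k L` attached to the conjugate point `x^γ ∈ A^γ(k)` (`conjPoints γ`, then extension of scalars to `L` and
`pointsMulEquiv`) is carried by the isomorphism to the conjugate point `(x_L)^σ ∈ (A ⊗_k L)^σ (L)` (`conjPoints σ`)
of the `L`-point `x_L` of `A ⊗_k L` — Shimura's `t^σ` for an `L`-rational torsion point `t`, computed on the model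
(both lie over `Spec(σ ∘ ι) = Spec(ι ∘ γ) ≫ x : Spec L → A`). [cite: Shimura1998, §18.6 proof of Thm. 18.6, p. 128] -/
theorem map_conjugateBaseChangeAlongIso_hom_pointsMulEquiv_extendScalars_conjPoints (x : A.Points k) :
    AlgPoints.map (conjugateBaseChangeAlongIso γ σ hσ A).hom.hom.hom.hom
        ((A.conjugate γ).pointsMulEquiv L
          (AlgPoints.extendScalars (A.conjugate γ).X k L (A.conjPoints γ x))) =
      (A.baseChange L).conjPoints σ (A.pointsMulEquiv L (AlgPoints.extendScalars A.X k L x)) := by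
  apply Points.conjugate_baseChange_ext
  -- right-hand side: `Spec σ ≫ Spec ι ≫ x`
  have hR : ((A.baseChange L).conjPoints σ (A.pointsMulEquiv L (AlgPoints.extendScalars A.X k L x))).left ≫
      baseChangeHomFst σ.toRingHom (A.baseChange L).X ≫ pullback.fst A.X.hom (bcSpec k L) =
        Spec.map (CommRingCat.ofHom σ.toRingHom) ≫ Spec.map (CommRingCat.ofHom (algebraMap k L)) ≫ x.left := by
    have hQ : (A.pointsMulEquiv L (AlgPoints.extendScalars A.X k L x)).left ≫ pullback.fst A.X.hom (bcSpec k L) =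
        Spec.map (CommRingCat.ofHom (algebraMap k L)) ≫ x.left := by
      rw [pointsMulEquiv_apply, pointsEquiv_apply_left_comp_fst, AlgPoints.extendScalars_apply, Over.comp_left,
        AlgPoints.specOverMap_left]
    rw [conjPoints_left_comp_fst_assoc]
    simp only [Category.assoc, hQ]
  -- left-hand side: `Spec ι ≫ Spec γ ≫ x`, through the first-projection formula of `e`
  have hL : (AlgPoints.map (conjugateBaseChangeAlongIso γ σ hσ A).hom.hom.hom.hom
        ((A.conjugate γ).pointsMulEquiv L
          (AlgPoints.extendScalars (A.conjugate γ).X k L (A.conjPoints γ x)))).left ≫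
      baseChangeHomFst σ.toRingHom (A.baseChange L).X ≫ pullback.fst A.X.hom (bcSpec k L) =
        Spec.map (CommRingCat.ofHom (algebraMap k L)) ≫ Spec.map (CommRingCat.ofHom γ.toRingHom) ≫ x.left := by
    rw [AlgPoints.map_apply, Over.comp_left, Category.assoc]
    change ((A.conjugate γ).pointsMulEquiv L _).left ≫
        Hom.toSchemeHom (conjugateBaseChangeAlongIso γ σ hσ A).hom ≫ _ ≫ _ = _
    have hQ' : ((A.conjugate γ).pointsMulEquiv L
          (AlgPoints.extendScalars (A.conjugate γ).X k L (A.conjPoints γ x))).left ≫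
        pullback.fst (A.conjugate γ).X.hom (bcSpec k L) =
          Spec.map (CommRingCat.ofHom (algebraMap k L)) ≫ (A.conjPoints γ x).left := by
      rw [pointsMulEquiv_apply, pointsEquiv_apply_left_comp_fst, AlgPoints.extendScalars_apply, Over.comp_left,
        AlgPoints.specOverMap_left]
    rw [toSchemeHom_conjugateBaseChangeAlongIso_hom_comp_fst_fst, ← Category.assoc, hQ', Category.assoc]
    change _ ≫ (A.conjPoints γ x).left ≫ baseChangeHomFst γ.toRingHom A.X = _
    rw [conjPoints_left_comp_fst]
  rw [hL, hR, ← Category.assoc, ← Category.assoc (Spec.map _), ← Spec.map_comp, ← Spec.map_comp,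
    ← CommRingCat.ofHom_comp, ← CommRingCat.ofHom_comp]
  congr 3
  exact RingHom.ext fun y ↦ (hσ y).symm

end AV

end AbelianVariety

end Literature.AlgebraicGeometry.Motives
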